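import Summits.FinalStateConjecture.FinalStateConjecture.Theorems.EIHFluxBalanceInertialRecessionRechartTransfer2

/-!
# Route EIHFluxBalance — `InertialRecession`, re-charting: the causal transfer with a GENERAL
# CLOCK DICTIONARY (non-affine model time; clock charts of holes with wandering velocities)

Helper file for the crux `stmt-FinalStateConjecture-10166`
(`Summit.FinalStateConjecture.FinalStateConjecture.Theses.EIHFluxBalance.InertialRecession`),
stub `stub_rechart` (the transfer P2 of line `sublinear-is-free-clean-window-charges`).

`…RechartTransfer2.exterior_subset_certified_union_causalPast₂` assumes an AFFINE lab↔model time
dictionary `|t*(y) − αᵢx⁰| ≤ βᵢ rᵢ` (constant `αᵢ, βᵢ`; correct for charts built around a final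
boost). The clock charts of …StubRechart3Package (Cesàro velocities only, frames slaved but not
convergent) have model time `τ` with lab time `T₀(τ) + tilt`, `T₀` bi-Lipschitz but NOT affine, and a
tilt coefficient `βᵢ(t) ≍ γ|vᵢ(t)|` that wanders. This file is the same transfer with the dictionary
`|t*(y) − θᵢ(x⁰)| ≤ βᵢ(x⁰) rᵢ` for arbitrary clock functions `θᵢ` and nonnegative tilt functions
`βᵢ(·)`: `exists_model_point_of_ball₃`, the zone lemma `mem_causalPast_slab_of_zone₃` and
`exterior_subset_certified_union_causalPast₃`; the proofs are those of …RechartTransfer,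
…RechartZone2, …RechartTransfer2 verbatim with `αᵢ t ↦ θᵢ t`, `βᵢ ↦ βᵢ t`. The threshold
hypotheses become: `hT₂ : ∀ t ≥ T₂ τ₁, τ₁ + βᵢ(t) Rzᵢ ≤ θᵢ(t)`, `hmesh : S ≤ θᵢ t − βᵢ(t)Rb t`,
`Rb t ≤ Rᵢ(θᵢ t − βᵢ(t) Rb t)`, `θᵢ t + βᵢ(t) Rb t ≤ t` (the last is the one the assembler must earn
by an ADAPTED meshing profile: `βᵢ(t)Rb(t)` must stay below the accumulated clock slack
`t − θᵢ(t) = ∫(ũ⁰ − 1) + const`, which is possible with `Rb → ∞` because recurrent macroscopic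
painted speeds make the slack diverge while vanishing speeds kill the tilt), and `hzone` likewise.
[O'Neill 1983, Ch. 14, pp. 402–404; folklore causal bookkeeping]
-/

noncomputable section

set_option linter.dupNamespace false

open Set Filter Topology Function TopologicalSpace Literature.Geometry.Lorentzian
open scoped Manifold ContDiff

namespace Summit.FinalStateConjecture.FinalStateConjecture.Theorems

section Transfer

variable {𝓢 : Spacetime 4} {N : ℕ} (U : Opens E4) (Φ : U → 𝓢.carrier) (O : Set 𝓢.carrier)
  (Pext : U → Prop) (rp : Fin N → U → ℝ) (rH δ Rz : Fin N → ℝ)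
  (Kb : Fin N → ModelBackground) (ψ : ∀ i, (Kb i).domain → 𝓢.carrier)
  (R : Fin N → ℝ → ℝ) (hRm : ∀ i, Monotone (R i))
  (U₀ : Opens E4) (hU₀ : U₀ ≤ U) (Rb T₂ : ℝ → ℝ) (θ β : Fin N → ℝ → ℝ) {τ₀ τ₀' τT Tc S : ℝ}
  (hτ : τ₀ < τ₀') (hτT : τT < τ₀') (hTc : Tc ≤ τ₀') (hβ : ∀ i t, 0 ≤ β i t)
  -- exhaustion (vii), lab-time causality, `O` below the late image
  (hexh : ∀ t₁ : ℝ, τ₀ < t₁ → O \ Φ '' {x : U | t₁ < x.1 0 ∧ Pext x} ⊆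
    𝓢.metric.causalPast 𝓢.timeOrientation (Φ '' {x : U | x.1 0 = t₁ ∧ Pext x}))
  (hT : ∀ x x' : U, τT < x.1 0 → Pext x → τT < x'.1 0 → Pext x' →
    Φ x' ∈ 𝓢.metric.causalFuture 𝓢.timeOrientation {Φ x} → x.1 0 ≤ x'.1 0)
  (hOcl : ∀ p ∈ O, ∀ z : 𝓢.carrier, z ∈ 𝓢.metric.causalFuture 𝓢.timeOrientation {p} →
    z ∈ 𝓢.metric.causalPast 𝓢.timeOrientation (Φ '' {x : U | τ₀ < x.1 0 ∧ Pext x}) → z ∈ O)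
  (himO : Φ '' {x : U | τ₀ < x.1 0 ∧ Pext x} ⊆ O)
  -- the charts
  (hemb : IsOpenEmbedding (({x : U | τ₀ < x.1 0} : Set U).restrict Φ))
  (hrpc : ∀ i, Continuous (rp i))
  (hψemb : ∀ i, IsOpenEmbedding (ψ i)) (hKt : ∀ i, Continuous (Kb i).time)
  (hKr : ∀ i, Continuous (Kb i).radius)
  (hlab : ∀ (i : Fin N) (y : (Kb i).domain) (x : U), Φ x = ψ i y → Tc ≤ x.1 0 →
    (Kb i).radius y.1 < Rz i → rp i x = (Kb i).radius y.1)
  (hsplit : ∀ x : U, τ₀' ≤ x.1 0 → Pext x → x.1 ∈ (U₀ : Set E4) ∨ ∃ i, rp i x ≤ Rb (x.1 0))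
  (hPext : ∀ (x : U) (i : Fin N), Pext x → rH i < rp i x)
  (hRz : ∀ (i : Fin N) (t : ℝ), τ₀' ≤ t → Rz i ≤ Rb t) (hδRz : ∀ i, rH i + δ i ≤ Rz i)
  -- certified static flow, meshing
  (hstat : ∀ (i : Fin N) (y : (Kb i).domain) (τ₁ : ℝ), τ₀' ≤ τ₁ → S ≤ (Kb i).time y.1 →
    (Kb i).time y.1 ≤ τ₁ → rH i + δ i ≤ (Kb i).radius y.1 →
    (Kb i).radius y.1 ≤ R i ((Kb i).time y.1) →
      ψ i y ∈ 𝓢.metric.causalPast 𝓢.timeOrientation (ψ i '' (Kb i).truncTimeSlab (R i τ₁) τ₁))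

include hRm hTc hβ in
/-- **Dictionary for ball points.** A late ball point of hole `i` (lab time `t ≥ τ₀'`, painted
radius in `(rHᵢ, Rb(t)]`) is `ψᵢ y` for a model point `y` with `S ≤ t*(y) ≤ θᵢ(t) + βᵢ(t)Rb(t)` and
`rᵢ(y) ≤ Rᵢ(t*(y))`. [folklore] -/
theorem exists_model_point_of_ball₃
  (hcov : ∀ (i : Fin N) (x : U), Tc ≤ x.1 0 → rH i < rp i x → rp i x ≤ Rb (x.1 0) →
    ∃ y : (Kb i).domain, ψ i y = Φ x ∧ (Kb i).radius y.1 = rp i x ∧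
      |(Kb i).time y.1 - θ i (x.1 0)| ≤ β i (x.1 0) * rp i x)
  (hmesh : ∀ (i : Fin N) (t : ℝ), τ₀' ≤ t → S ≤ θ i t - β i t * Rb t ∧
    Rb t ≤ R i (θ i t - β i t * Rb t) ∧ θ i t + β i t * Rb t ≤ t)
    (i : Fin N) (x : U) (hx : τ₀' ≤ x.1 0)
    (hxr : rH i < rp i x) (hxb : rp i x ≤ Rb (x.1 0)) :
    ∃ y : (Kb i).domain, ψ i y = Φ x ∧ S ≤ (Kb i).time y.1 ∧
      (Kb i).time y.1 ≤ θ i (x.1 0) + β i (x.1 0) * Rb (x.1 0) ∧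
      (Kb i).radius y.1 ≤ R i ((Kb i).time y.1) := by
  obtain ⟨y, hyψ, hyr, hyt⟩ := hcov i x (hTc.trans hx) hxr hxb
  obtain ⟨hS, hRb, -⟩ := hmesh i (x.1 0) hx
  have hβb : β i (x.1 0) * rp i x ≤ β i (x.1 0) * Rb (x.1 0) := mul_le_mul_of_nonneg_left hxb (hβ i _)
  have ht1 : θ i (x.1 0) - β i (x.1 0) * Rb (x.1 0) ≤ (Kb i).time y.1 := by
    have := (abs_le.mp hyt).1; linarith
  have ht2 : (Kb i).time y.1 ≤ θ i (x.1 0) + β i (x.1 0) * Rb (x.1 0) := by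
    have := (abs_le.mp hyt).2; linarith
  refine ⟨y, hyψ, hS.trans ht1, ht2, ?_⟩
  rw [hyr]
  exact hxb.trans (hRb.trans (hRm i ht1))

include hRm hTc hemb hrpc hψemb hKt hKr hlab hPext hRz hδRz hstat in
/-- **The zone lemma.** Let `γ` be a future causal curve on `[a, b]` of late chart points with lab
time `≥ τ₁`, starting at a hole-chart point `ψᵢ y₁` with `t*(y₁) ≤ τ₁` and `r(y₁) < Rzᵢ`, whose
endpoint has hole time `≥ τ₁` if it is still within radius `Rzᵢ` of hole `i`. Then `γ a` lies in
`J⁻` of the slab `ψᵢ{t* = τ₁, r ≤ Rᵢ(τ₁)}`: either the hole time `τ₁` is taken along the curve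
inside the zone `{r < Rzᵢ}` (intermediate values through `ψᵢ`), or the curve first leaves the zone
(`sInf` of the closed exit set) at a point of painted radius exactly `Rzᵢ` (intermediate values of
the painted radius through `Φ`, and coverage), which is certified (`Rzᵢ ≥ r₊ + δ`) with hole time
`< τ₁`, so that the static flow carries it to the slab. Variant of `mem_causalPast_slab_of_zone`
(`…RechartZone`) with the model-to-lab dictionary required only INSIDE the zone (the re-charted
hole charts compress radii far out). [folklore] -/
theorem mem_causalPast_slab_of_zone₃
  (hcov : ∀ (i : Fin N) (x : U), Tc ≤ x.1 0 → rH i < rp i x → rp i x ≤ Rb (x.1 0) →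
    ∃ y : (Kb i).domain, ψ i y = Φ x ∧ (Kb i).radius y.1 = rp i x ∧
      |(Kb i).time y.1 - θ i (x.1 0)| ≤ β i (x.1 0) * rp i x)
  (hzone : ∀ (i : Fin N) (t : ℝ), τ₀' ≤ t → S ≤ θ i t - β i t * Rz i ∧
    Rz i ≤ R i (θ i t - β i t * Rz i) ∧ Rz i ≤ R i t)
    (i : Fin N) (τ₁ : ℝ) (hτ₁ : τ₀' ≤ τ₁)
    {γ : ℝ → 𝓢.carrier} {a b : ℝ} (hab : a ≤ b)
    (hγ : 𝓢.metric.IsFutureCausalCurveOn 𝓢.timeOrientation γ (Icc a b))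
    (hlate : ∀ s ∈ Icc a b, ∃ x : U, Φ x = γ s ∧ τ₀ < x.1 0 ∧ Pext x ∧ τ₁ ≤ x.1 0)
    (y₁ : (Kb i).domain) (hy₁ : ψ i y₁ = γ a) (hy₁t : (Kb i).time y₁.1 ≤ τ₁)
    (hy₁r : (Kb i).radius y₁.1 < Rz i)
    (hend : ∀ y : (Kb i).domain, ψ i y = γ b → (Kb i).radius y.1 < Rz i →
      τ₁ ≤ (Kb i).time y.1) :
    γ a ∈ 𝓢.metric.causalPast 𝓢.timeOrientation (ψ i '' (Kb i).truncTimeSlab (R i τ₁) τ₁) := by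
  set slab : Set 𝓢.carrier := ψ i '' (Kb i).truncTimeSlab (R i τ₁) τ₁ with hslab
  set W : Set 𝓢.carrier := ψ i '' {y | (Kb i).radius y.1 < Rz i} with hW
  have hWo : IsOpen W :=
    (hψemb i).isOpenMap _ (isOpen_lt ((hKr i).comp continuous_subtype_val) continuous_const)
  have hγc : ContinuousOn γ (Icc a b) := continuousOn_of_isFutureCausalCurveOn hγ
  -- injectivity of the lab chart on the late region
  have hinj : ∀ x x' : U, τ₀ < x.1 0 → τ₀ < x'.1 0 → Φ x = Φ x' → x = x' := by
    intro x x' hx hx' h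
    have := hemb.injective
      (show ({x : U | τ₀ < x.1 0} : Set U).restrict Φ ⟨x, hx⟩ =
        ({x : U | τ₀ < x.1 0} : Set U).restrict Φ ⟨x', hx'⟩ from h)
    exact congrArg Subtype.val this
  -- painted radius of zone points
  have hWrad : ∀ (s : ℝ) (x : U), Tc ≤ x.1 0 → Φ x = γ s → γ s ∈ W → rp i x < Rz i := by
    rintro s x hx hxs ⟨y, hy, hys⟩
    rw [hlab i y x (hxs.trans hys.symm) hx hy]; exact hy
  have hconcl : ∀ s ∈ Icc a b, γ s ∈ slab →
      γ a ∈ 𝓢.metric.causalPast 𝓢.timeOrientation slab := fun s hs h ↦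
    mem_causalPast_of_curve hγ hs h
  -- the exit set
  set B : Set ℝ := Icc a b ∩ γ ⁻¹' Wᶜ with hB
  have hBc : IsClosed B := hγc.preimage_isClosed_of_isClosed isClosed_Icc hWo.isClosed_compl
  have haW : γ a ∈ W := ⟨y₁, hy₁r, hy₁⟩
  by_cases hBne : B.Nonempty
  · -- EXIT: the curve leaves the zone, first at `σ₂`
    set σ₂ : ℝ := sInf B with hσ₂
    have hbdd : BddBelow B := ⟨a, fun s hs ↦ hs.1.1⟩
    have hσ₂B : σ₂ ∈ B := hBc.csInf_mem hBne hbdd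
    have hσ₂I : σ₂ ∈ Icc a b := hσ₂B.1
    have hσ₂W : γ σ₂ ∉ W := hσ₂B.2
    have hbefore : ∀ s, a ≤ s → s < σ₂ → γ s ∈ W := fun s has hs ↦ by
      by_contra h
      have : σ₂ ≤ s := csInf_le hbdd ⟨⟨has, hs.le.trans hσ₂I.2⟩, h⟩
      linarith
    have haσ₂ : a < σ₂ := lt_of_le_of_ne hσ₂I.1 fun h ↦ hσ₂W (h ▸ haW)
    obtain ⟨x₂, hx₂, hx₂0, hx₂P, hx₂τ⟩ := hlate σ₂ hσ₂I
    have hx₂τ' : τ₀' ≤ x₂.1 0 := hτ₁.trans hx₂τ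
    -- the painted radius at the exit point is exactly `Rz i`
    have hle : rp i x₂ ≤ Rz i := by
      by_contra h
      rw [not_le] at h
      obtain ⟨xa, hxa, hxa0, -, hxaτ⟩ := hlate a ⟨le_rfl, hab⟩
      have hxar : rp i xa < Rz i := hWrad a xa (hTc.trans (hτ₁.trans hxaτ)) hxa haW
      have hmaps : MapsTo γ (Icc a σ₂) (range (({x : U | τ₀ < x.1 0} : Set U).restrict Φ)) := by
        intro s hs
        obtain ⟨x, hx, hx0, -, -⟩ := hlate s ⟨hs.1, hs.2.trans hσ₂I.2⟩
        exact ⟨⟨x, hx0⟩, hx⟩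
      have hlateTc : ∀ s ∈ Icc a σ₂, ∀ x : U, Φ x = γ s → τ₀ < x.1 0 → Tc ≤ x.1 0 := by
        intro s hs x hx hx0
        obtain ⟨x', hx', hx'0, -, hx'τ⟩ := hlate s ⟨hs.1, hs.2.trans hσ₂I.2⟩
        have : x' = x := hinj x' x hx'0 hx0 (hx'.trans hx.symm)
        rw [← this]; exact hTc.trans (hτ₁.trans hx'τ)
      obtain ⟨s, hs, ⟨x, hx0⟩, hxs, hxr⟩ := exists_mem_Icc_apply_eq_of_curve hemb haσ₂.le
        (hγc.mono (Icc_subset_Icc le_rfl hσ₂I.2)) hmaps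
        (f := fun x : ({x : U | τ₀ < x.1 0} : Set U) ↦ rp i x.1)
        ((hrpc i).comp continuous_subtype_val)
        (xa := ⟨xa, hxa0⟩) (xb := ⟨x₂, hx₂0⟩) hxa hx₂ (c := Rz i) hxar.le h.le
      rcases eq_or_lt_of_le hs.2 with hsσ | hsσ
      · have : x = x₂ := hinj x x₂ hx0 hx₂0 (hxs.trans (hsσ ▸ hx₂).symm)
        have hxr' : rp i x = Rz i := hxr
        rw [this] at hxr'
        linarith
      · have h1 := hWrad s x (hlateTc s hs x hxs hx0) hxs (hbefore s hs.1 hsσ)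
        have hxr' : rp i x = Rz i := hxr
        linarith
    have hge : Rz i ≤ rp i x₂ := by
      by_contra h
      rw [not_le] at h
      obtain ⟨y, hyψ, hyr, -⟩ := hcov i x₂ (hTc.trans hx₂τ') (hPext x₂ i hx₂P)
        (h.le.trans (hRz i _ hx₂τ'))
      exact hσ₂W ⟨y, by rw [mem_setOf_eq, hyr]; exact h, hyψ.trans hx₂⟩
    obtain ⟨y₂, hy₂ψ, hy₂r, hy₂t⟩ := hcov i x₂ (hTc.trans hx₂τ') (hPext x₂ i hx₂P)
      (hle.trans (hRz i _ hx₂τ'))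
    have hx₂r : rp i x₂ = Rz i := le_antisymm hle hge
    rw [hx₂r] at hy₂r hy₂t
    have hy₂γ : ψ i y₂ = γ σ₂ := hy₂ψ.trans hx₂
    -- up to `σ₂` the curve runs in the image of `ψ i`
    have hmapsψ : MapsTo γ (Icc a σ₂) (range (ψ i)) := by
      intro s hs
      rcases eq_or_lt_of_le hs.2 with h | h
      · rw [h, ← hy₂γ]; exact mem_range_self _
      · obtain ⟨y, -, hy⟩ := hbefore s hs.1 h
        exact ⟨y, hy⟩
    obtain ⟨hS, hRzR, -⟩ := hzone i (x₂.1 0) hx₂τ'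
    obtain ⟨-, -, hRzτ⟩ := hzone i τ₁ hτ₁
    rcases le_or_gt τ₁ ((Kb i).time y₂.1) with ht | ht
    · -- the hole time `τ₁` is taken on `[a, σ₂]`
      obtain ⟨s, hs, y, hys, hyt⟩ := exists_mem_Icc_apply_eq_of_curve (hψemb i) haσ₂.le
        (hγc.mono (Icc_subset_Icc le_rfl hσ₂I.2)) hmapsψ
        (f := fun y : (Kb i).domain ↦ (Kb i).time y.1) ((hKt i).comp continuous_subtype_val)
        (xa := y₁) (xb := y₂) hy₁ hy₂γ hy₁t ht
      have hyr : (Kb i).radius y.1 ≤ Rz i := by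
        rcases eq_or_lt_of_le hs.2 with h | h
        · have : y = y₂ := (hψemb i).injective (hys.trans (h ▸ hy₂γ.symm))
          rw [this, hy₂r]
        · obtain ⟨y', hy'r, hy'⟩ := hbefore s hs.1 h
          have : y' = y := (hψemb i).injective (hy'.trans hys.symm)
          rw [← this]; exact le_of_lt hy'r
      refine hconcl s ⟨hs.1, hs.2.trans hσ₂I.2⟩ ⟨y, ?_, hys⟩
      rw [ModelBackground.mem_truncTimeSlab]
      exact ⟨hyt, hyr.trans hRzτ⟩
    · -- exit at a certified point with hole time `< τ₁`: static flow to the slab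
      have ht1 : θ i (x₂.1 0) - β i (x₂.1 0) * Rz i ≤ (Kb i).time y₂.1 := by
        have := (abs_le.mp hy₂t).1; linarith
      have hy₂J := hstat i y₂ τ₁ hτ₁ (hS.trans ht1) ht.le (by rw [hy₂r]; exact hδRz i)
        (by rw [hy₂r]; exact hRzR.trans (hRm i ht1))
      rw [hy₂γ] at hy₂J
      exact mem_causalPast_of_subset_causalPast
        (WithTop.coe_le_coe.mpr le_top : (2 : ℕ∞ω) ≤ ∞)
        (mem_causalPast_singleton_of_curve hγ hσ₂I) (singleton_subset_iff.mpr hy₂J)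
  · -- WHOLE: the curve never leaves the zone
    have hallW : ∀ s ∈ Icc a b, γ s ∈ W := fun s hs ↦ by
      by_contra h
      exact hBne ⟨s, hs, h⟩
    obtain ⟨yb, hybr, hyb⟩ := hallW b ⟨hab, le_rfl⟩
    have hybt : τ₁ ≤ (Kb i).time yb.1 := hend yb hyb hybr
    have hmapsψ : MapsTo γ (Icc a b) (range (ψ i)) := fun s hs ↦ by
      obtain ⟨y, -, hy⟩ := hallW s hs
      exact ⟨y, hy⟩
    obtain ⟨s, hs, y, hys, hyt⟩ := exists_mem_Icc_apply_eq_of_curve (hψemb i) hab hγc hmapsψ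
      (f := fun y : (Kb i).domain ↦ (Kb i).time y.1) ((hKt i).comp continuous_subtype_val)
      (xa := y₁) (xb := yb) hy₁ hyb hy₁t hybt
    obtain ⟨y', hy'r, hy'⟩ := hallW s hs
    have hyy : y' = y := (hψemb i).injective (hy'.trans hys.symm)
    obtain ⟨-, -, hRzτ⟩ := hzone i τ₁ hτ₁
    refine hconcl s hs ⟨y, ?_, hys⟩
    rw [ModelBackground.mem_truncTimeSlab]
    exact ⟨hyt, (hyy ▸ hy'r).le.trans hRzτ⟩

include hRm hτ hτT hTc hβ hexh hT hOcl himO hemb hrpc hψemb hKt hKr hlab hsplit hPext hRz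
  hδRz hstat in
/-- **The transfer without loitering.** For every chart time `τ₁ ≥ τ₀'`, every point of `O` is
certified-late after `τ₁` or lies in the causal past of the certified slab at `τ₁`. As in
`exterior_subset_certified_union_causalPast`, except that a ball point with lagging hole time in
the uncertifiable layer `r < r₊ + δ` is carried to a tilted slab by the ZONE LEMMA applied to an
exhaustion curve from it to the lab slab `t₂ = max (x⁰ + 1) (T₂ τ₁)` (all of whose points are late
chart points, `exists_late_preimage_of_curve`). [folklore] -/
theorem exterior_subset_certified_union_causalPast₃
  (hcov : ∀ (i : Fin N) (x : U), Tc ≤ x.1 0 → rH i < rp i x → rp i x ≤ Rb (x.1 0) →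
    ∃ y : (Kb i).domain, ψ i y = Φ x ∧ (Kb i).radius y.1 = rp i x ∧
      |(Kb i).time y.1 - θ i (x.1 0)| ≤ β i (x.1 0) * rp i x)
  (hT₂ : ∀ (i : Fin N) (τ₁ : ℝ), (∀ t, T₂ τ₁ ≤ t → τ₁ + β i t * Rz i ≤ θ i t) ∧ τ₁ ≤ T₂ τ₁)
  (hmesh : ∀ (i : Fin N) (t : ℝ), τ₀' ≤ t → S ≤ θ i t - β i t * Rb t ∧
    Rb t ≤ R i (θ i t - β i t * Rb t) ∧ θ i t + β i t * Rb t ≤ t)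
  (hzone : ∀ (i : Fin N) (t : ℝ), τ₀' ≤ t → S ≤ θ i t - β i t * Rz i ∧
    Rz i ≤ R i (θ i t - β i t * Rz i) ∧ Rz i ≤ R i t)
    (τ₁ : ℝ) (hτ₁ : τ₀' ≤ τ₁) :
    O ⊆ ((Φ ∘ Opens.inclusion hU₀) '' {x : U₀ | τ₁ < x.1 0} ∪
        ⋃ i, ψ i '' {y | τ₁ < (Kb i).time y.1 ∧ (Kb i).radius y.1 ≤ R i ((Kb i).time y.1)}) ∪
      𝓢.metric.causalPast 𝓢.timeOrientation
        ((Φ ∘ Opens.inclusion hU₀) '' {x : U₀ | x.1 0 = τ₁} ∪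
          ⋃ i, ψ i '' (Kb i).truncTimeSlab (R i τ₁) τ₁) := by
  set certS : Set 𝓢.carrier := (Φ ∘ Opens.inclusion hU₀) '' {x : U₀ | x.1 0 = τ₁} ∪
    ⋃ i, ψ i '' (Kb i).truncTimeSlab (R i τ₁) τ₁ with hcertS
  have hholeS : ∀ i, ψ i '' (Kb i).truncTimeSlab (R i τ₁) τ₁ ⊆ certS := fun i ↦
    (subset_iUnion (fun i ↦ ψ i '' (Kb i).truncTimeSlab (R i τ₁) τ₁) i).trans subset_union_right
  have hJmono : ∀ i, 𝓢.metric.causalPast 𝓢.timeOrientation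
      (ψ i '' (Kb i).truncTimeSlab (R i τ₁) τ₁) ⊆
        𝓢.metric.causalPast 𝓢.timeOrientation certS := fun i ↦
    LorentzianMetric.causalFuture_mono (hholeS i)
  -- injectivity of the lab chart on the late region
  have hinj : ∀ x x' : U, τ₀ < x.1 0 → τ₀ < x'.1 0 → Φ x = Φ x' → x = x' := by
    intro x x' hx hx' h
    have := hemb.injective
      (show ({x : U | τ₀ < x.1 0} : Set U).restrict Φ ⟨x, hx⟩ =
        ({x : U | τ₀ < x.1 0} : Set U).restrict Φ ⟨x', hx'⟩ from h)
    exact congrArg Subtype.val this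
  -- REACH: a late ball point with lab time `≥ τ₁` and hole time `≤ τ₁` reaches its tilted slab
  have hreach : ∀ (i : Fin N) (x : U), τ₀' ≤ x.1 0 → Pext x → τ₁ ≤ x.1 0 →
      ∀ y : (Kb i).domain, ψ i y = Φ x → S ≤ (Kb i).time y.1 → (Kb i).time y.1 ≤ τ₁ →
        (Kb i).radius y.1 ≤ R i ((Kb i).time y.1) →
        Φ x ∈ 𝓢.metric.causalPast 𝓢.timeOrientation
          (ψ i '' (Kb i).truncTimeSlab (R i τ₁) τ₁) := by
    intro i x hxτ hxP hx₁ y hyψ hyS hyt hyR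
    by_cases hcert : rH i + δ i ≤ (Kb i).radius y.1
    · rw [← hyψ]; exact hstat i y τ₁ hτ₁ hyS hyt hcert hyR
    rw [not_le] at hcert
    have hyRz : (Kb i).radius y.1 < Rz i := hcert.trans_le (hδRz i)
    -- an exhaustion curve from `Φ x` to the lab slab `t₂`
    set t₂ : ℝ := max (x.1 0 + 1) (T₂ τ₁) with ht₂
    have ht₂x : x.1 0 < t₂ := (lt_add_one _).trans_le (le_max_left _ _)
    have ht₂T : T₂ τ₁ ≤ t₂ := le_max_right _ _
    have ht₂τ₁ : τ₁ ≤ t₂ := (hT₂ i τ₁).2.trans ht₂T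
    have ht₂0 : τ₀ < t₂ := (hτ.trans_le (hτ₁.trans ht₂τ₁))
    have hx0 : τ₀ < x.1 0 := hτ.trans_le hxτ
    have hxO : Φ x ∈ O := himO ⟨x, ⟨hx0, hxP⟩, rfl⟩
    have hnot : Φ x ∉ Φ '' {x' : U | t₂ < x'.1 0 ∧ Pext x'} := by
      rintro ⟨x', ⟨h1, -⟩, h⟩
      have := hinj x' x (ht₂0.trans h1) hx0 h
      rw [this] at h1
      linarith
    have hJ := hexh t₂ ht₂0 ⟨hxO, hnot⟩
    rcases exists_isFutureCausalCurveOn_of_mem_causalPast hJ with hmem | ⟨γ, a, b, hab, hγ, hγa, hγb⟩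
    · obtain ⟨x', ⟨h1, -⟩, h⟩ := hmem
      have := hinj x' x (by rw [h1]; exact ht₂0) hx0 h
      rw [this] at h1
      linarith
    have hγb' : γ b ∈ Φ '' {x' : U | τ₀ < x'.1 0 ∧ Pext x'} := by
      obtain ⟨x', ⟨h1, h2⟩, h⟩ := hγb
      exact ⟨x', ⟨by rw [h1]; exact ht₂0, h2⟩, h⟩
    have hlate : ∀ s ∈ Icc a b, ∃ x' : U, Φ x' = γ s ∧ τ₀ < x'.1 0 ∧ Pext x' ∧ τ₁ ≤ x'.1 0 := by
      intro s hs
      obtain ⟨x', hx', hx'0, hx'P, hx'x⟩ := exists_late_preimage_of_curve U Φ O Pext hτ hτT hexh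
        hT hOcl x hxτ hxP hxO hγ hγa hγb' hs
      exact ⟨x', hx', hx'0, hx'P, hx₁.trans hx'x⟩
    have hend : ∀ y' : (Kb i).domain, ψ i y' = γ b → (Kb i).radius y'.1 < Rz i →
        τ₁ ≤ (Kb i).time y'.1 := by
      intro y' hy'b hy'r
      obtain ⟨xb, ⟨hxb0, hxbP⟩, hxb⟩ := hγb
      have hxb0' : τ₀ < xb.1 0 := by rw [hxb0]; exact ht₂0
      have hxbτ : τ₀' ≤ xb.1 0 := by rw [hxb0]; exact hτ₁.trans ht₂τ₁
      have hrb : rp i xb < Rz i := by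
        rw [hlab i y' xb (hxb.trans hy'b.symm) (hTc.trans hxbτ) hy'r]; exact hy'r
      obtain ⟨y'', hy''ψ, -, hy''t⟩ := hcov i xb (hTc.trans hxbτ) (hPext xb i hxbP)
        (hrb.le.trans (hRz i _ hxbτ))
      have hyy : y'' = y' := (hψemb i).injective (by rw [hy''ψ, hxb, hy'b])
      rw [hyy, hxb0] at hy''t
      have h1 : θ i t₂ - β i t₂ * rp i xb ≤ (Kb i).time y'.1 := by
        have := (abs_le.mp hy''t).1; linarith
      have h2 : β i t₂ * rp i xb ≤ β i t₂ * Rz i := mul_le_mul_of_nonneg_left hrb.le (hβ i _)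
      have h3 : τ₁ + β i t₂ * Rz i ≤ θ i t₂ := (hT₂ i τ₁).1 t₂ ht₂T
      linarith
    rw [← hγa]
    exact mem_causalPast_slab_of_zone₃ U Φ Pext rp rH δ Rz Kb ψ R hRm Rb θ β hTc hemb hrpc hψemb
      hKt hKr hlab hPext hRz hδRz hstat hcov hzone i τ₁ hτ₁ hab.le hγ hlate y (hyψ.trans hγa.symm)
      hyt hyRz hend
  -- Claim A: the lab slab `τ₁` of the painted exterior lies in `J⁻(certS)`
  have hA : Φ '' {x : U | x.1 0 = τ₁ ∧ Pext x} ⊆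
      𝓢.metric.causalPast 𝓢.timeOrientation certS := by
    rintro _ ⟨x, ⟨hx0, hxP⟩, rfl⟩
    have hxτ : τ₀' ≤ x.1 0 := by rw [hx0]; exact hτ₁
    rcases hsplit x hxτ hxP with hU | ⟨i, hi⟩
    · exact LorentzianMetric.subset_causalPast _ _ _ (Or.inl ⟨⟨x.1, hU⟩, hx0, rfl⟩)
    · obtain ⟨y, hyψ, hyS, hyt, hyR⟩ := exists_model_point_of_ball₃ U Φ rp rH Kb ψ R hRm Rb θ β
        hTc hβ hcov hmesh i x hxτ (hPext x i hxP) hi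
      obtain ⟨-, -, h3⟩ := hmesh i (x.1 0) hxτ
      have hy₁ : (Kb i).time y.1 ≤ τ₁ := by rw [← hx0]; exact hyt.trans h3
      exact hJmono i (hreach i x hxτ hxP hx0.ge y hyψ hyS hy₁ hyR)
  -- Claim B: the painted exterior after lab time `τ₁` is certified-late or in `J⁻(certS)`
  have hB : Φ '' {x : U | τ₁ < x.1 0 ∧ Pext x} ⊆
      ((Φ ∘ Opens.inclusion hU₀) '' {x : U₀ | τ₁ < x.1 0} ∪
        ⋃ i, ψ i '' {y | τ₁ < (Kb i).time y.1 ∧ (Kb i).radius y.1 ≤ R i ((Kb i).time y.1)}) ∪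
      𝓢.metric.causalPast 𝓢.timeOrientation certS := by
    rintro _ ⟨x, ⟨hx0, hxP⟩, rfl⟩
    have hxτ : τ₀' ≤ x.1 0 := hτ₁.trans hx0.le
    rcases hsplit x hxτ hxP with hU | ⟨i, hi⟩
    · exact Or.inl (Or.inl ⟨⟨x.1, hU⟩, hx0, rfl⟩)
    · obtain ⟨y, hyψ, hyS, -, hyR⟩ := exists_model_point_of_ball₃ U Φ rp rH Kb ψ R hRm Rb θ β
        hTc hβ hcov hmesh i x hxτ (hPext x i hxP) hi
      rcases lt_or_ge τ₁ ((Kb i).time y.1) with h | h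
      · exact Or.inl (Or.inr (mem_iUnion.mpr ⟨i, y, ⟨h, hyR⟩, hyψ⟩))
      · exact Or.inr (hJmono i (hreach i x hxτ hxP hx0.le y hyψ hyS h hyR))
  -- exhaustion at lab time `τ₁`, then `J⁻ ∘ J⁻ = J⁻`
  intro p hp
  by_cases hpE : p ∈ Φ '' {x : U | τ₁ < x.1 0 ∧ Pext x}
  · exact hB hpE
  · have hJ := hexh τ₁ (hτ.trans_le hτ₁) ⟨hp, hpE⟩
    exact Or.inr (mem_causalPast_of_subset_causalPast
      (WithTop.coe_le_coe.mpr le_top : (2 : ℕ∞ω) ≤ ∞) hJ hA)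

end Transfer

/-- Threshold bookkeeping for the clock dictionary (registered stub `clock_threshold_rechart` of the
crux item): `τ₁ + β Rz ≤ θ`, `β, Rz ≥ 0` give `τ₁ ≤ θ`. [folklore] -/
theorem clock_threshold_rechart : ∀ {θt βt Rz τ₁ : ℝ}, τ₁ + βt * Rz ≤ θt → 0 ≤ βt → 0 ≤ Rz → τ₁ ≤ θt :=
  fun h hβ hR ↦ by nlinarith [mul_nonneg hβ hR]

end Summit.FinalStateConjecture.FinalStateConjecture.Theorems
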